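import Summits.BirchSwinnertonDyer.BirchSwinnertonDyer.Theorems.ErratumRoadFiveEulerHalfGenusFamilyPackage
import Summits.BirchSwinnertonDyer.BirchSwinnertonDyer.Theorems.ErratumRoadFiveEulerHalfGenusClassDataLocal
import Literature.NumberTheory.EllipticCurves.NonEisensteinPrimeOfSurjective
import Literature.NumberTheory.EllipticCurves.BSDSelmerCMPConverseHeegnerFieldProofs
import HarnessLib

/-!
# ErratumRoadFive ∕ EulerHalf ∕ genus line — toward (b1): the PER-DATUM dictionary of the CR3 swap engine on a served genus frame
# (helper, `--supports 23444`)

Cell bsd-stepL, prover seat `bsd-stepL-imc-p1` g42; plan `HOME/imc-p1/g42/B2BK-ASSEMBLY-PLAN-imc-p1-g42.md` §9.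

WHY.  cell CR3's frame-GENERIC Kolyvagin prime swap (McCallum Prop. 5.2 for an ARBITRARY labelled family `ys` on `W/K`,
`JET.Swap.shimuraWalk_swapSupplyAt_of_family`) consumes a per-DATUM dictionary {hbot, hB4, hceb, hA, hP, hsign, hsel, h44} — statements
about ANY `dm : KolyvaginFamilyData W K ι m` with `dm.y = ys m` at a square-free Gross–Kolyvagin level, at depth `p^M` with
`Frob = Frob_∞ (mod p^M)` GIVEN.  This file produces the datum-level entries on the genus frame (labels OFF `2N_W`, p729065) by the
«tower around the datum» device of `ShimuraWalk.toGeomPoints_derivedPoint_mem_invPoints_of_labelsAt` (any data at the proper divisors,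
`familyLabels_of_labelsAt` at the guard `2N_W`) over the family-form producers already used by the (b2b-κ) package:
* `exists_tower_through_datum` — the device.
* `isAdmissible_datum_of_frameProfile` (hA), `invPoints_datum_of_frameProfile` (hP), `sign_datum_of_frameProfile` (hsign, class form),
  `selmerLocalKer_datum_of_frameProfile` (the class-level `hSel` at every finite `𝔳 ∤ m`, INCLUDING `𝔳 ∣ p`, via the line owner's
  `localization_kolyvaginClass_mem_kummer_of_frameProfile`, p731685), `torsionBy_eq_bot_of_frameProfile` (hbot).
What remains for `SwapSupplyAt` on the genus family (next file): feed these + `Koly.hceb_family_of_surj` + the H47-guard (h44) + the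
root-class `hsel` (`Koly.familyRootKummer_of_selmerLocalKer` over `selmerLocalKer_datum_of_frameProfile`, `rootClass_familyData_mem_transverseKer`)
to the engine.

HONEST FRAMING: helper theorems; conditional on the printed facts where stated; no crux and no stub is closed; BSD is proved for no curve.
[cite: GrossLMS1991, §4 (4.4), Prop. 5.4, Prop. 6.2 (1)] [cite: McCallumLMS1991, §4 (4.3), §5 Prop. 5.2] [cite: Jetchev2008, Prop. 4.9]
presearch: in-tree only; no new literature.
-/

set_option autoImplicit false
-- D-0017: single-problem summit, so `Summit.BirchSwinnertonDyer.BirchSwinnertonDyer.…` repeats a namespace BY DESIGN.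
set_option linter.dupNamespace false

noncomputable section

open scoped Classical
open WeierstrassCurve NumberField Field IsDedekindDomain Literature.NumberTheory.EllipticCurves
  Literature.NumberTheory.EllipticCurves.ModularForms Literature.NumberTheory.GaloisRepresentations
  Literature.NumberTheory.GaloisRepresentations.DiscreteGaloisModule Literature.NumberTheory.EllipticCurves.KolyvaginCocycle
  Literature.NumberTheory.EllipticCurves.Jetchev2008
  Summit.BirchSwinnertonDyer.Rank1Residual Summit.BirchSwinnertonDyer.Rank1Residual.X11b
  Summit.BirchSwinnertonDyer.Rank1Residual.JET Summit.BirchSwinnertonDyer.Rank1Residual.JET.SelmerVocabulary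

namespace Summit.BirchSwinnertonDyer.BirchSwinnertonDyer.Theorems.GenusLine

variable {W A : WeierstrassCurve ℚ} {p q : ℕ} {K : Type} [Field K] [NumberField K]

/-! ## §1 The tower around a datum -/

/-- **A tower around a datum**: `dm` at the square-free level `m` (inert prime factors) on the family `ys` extends to data at every
divisor of `m` on `ys`, equal to `dm` at `m` itself (corner3-p2's device, exported). [cite: GrossLMS1991, §4 (4.1)] -/
theorem exists_tower_through_datum (hK : IsImaginaryQuadratic K) (ι : K →+* ℂ) {m : ℕ} (hm : Squarefree m)
    (hinert : ∀ q' ∈ m.primeFactors, (Ideal.span {(q' : 𝓞 K)}).IsPrime)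
    (ys : (m' : ℕ) → (W.baseChange (ringClassField K ι m')).toAffine.Point)
    (dm : KolyvaginFamilyData W K ι m) (hdy : dm.y = ys m) :
    ∃ d : (m' : ℕ) → m' ∣ m → KolyvaginFamilyData W K ι m',
      (∀ (m' : ℕ) (hm' : m' ∣ m), (d m' hm').y = ys m') ∧ d m dvd_rfl = dm := by
  have hm0 : m ≠ 0 := hm.ne_zero
  have hex : ∀ m' : ℕ, m' ∣ m → ∃ dm' : KolyvaginFamilyData W K ι m', dm'.y = ys m' ∧ ∀ h : m' = m, h ▸ dm' = dm := by
    intro m' hm'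
    by_cases h : m' = m
    · subst h
      exact ⟨dm, hdy, fun _ ↦ rfl⟩
    · obtain ⟨dm', hdm'⟩ := ShimuraWalk.exists_familyData_y_eq (W := W) hK ι (hm.squarefree_of_dvd hm')
        (fun q' hq' ↦ hinert q' (Nat.primeFactors_mono hm' hm0 hq')) ys
      exact ⟨dm', hdm', fun h' ↦ absurd h' h⟩
  choose d hdy' hdd using hex
  exact ⟨d, hdy', hdd m dvd_rfl rfl⟩

/-! ## §2 The per-datum dictionary on a served frame -/

section Frame

variable [W.IsElliptic] [W.IsGloballyMinimal] [A.IsElliptic] [Fact p.Prime] [Fact q.Prime]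

/-- The label guard at `2N_W` for GROSS–Kolyvagin levels on a served frame (`p ≠ 3`: the primes are odd).
[cite: GrossLMS1991, §3 (3.1)–(3.3)] -/
theorem guard_two_mul_level_of_frameProfile_gross (hprof : FrameProfile W A p q K) {m : ℕ}
    (hKol : ∀ q' ∈ m.primeFactors, IsKolyvaginPrime (W.conductorNorm ℤ) W K p q') :
    ∀ q' ∈ m.primeFactors, ¬ q' ∣ 2 * W.conductorNorm ℤ ∧ (Ideal.span {(q' : 𝓞 K)}).IsPrime := by
  intro q' hq'
  have h := hKol q' hq'
  refine ⟨fun hd ↦ ?_, h.2.2.2.2.1⟩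
  rcases (Nat.Prime.dvd_mul h.1).mp hd with h2 | hN
  · exact ne_two_of_isKolyvaginPrime_gross h (Fact.out : p.Prime) (p_ne_three_of_frameProfile hprof)
      ((Nat.prime_dvd_prime_iff_eq h.1 Nat.prime_two).mp h2)
  · exact h.2.1 hN

/-- **hA per datum**: admissible `E(K[m]) ⊆ E(K̄)` at every `p^M` on a served frame (`ρ̄` onto ⟹ no `p`-power torsion in `E(K[m])`).
[cite: McCallumLMS1991, §4 (5)] [cite: GrossLMS1991, §4, Lemma 4.3] -/
theorem isAdmissible_datum_of_frameProfile (S : GenusHeegnerSettingRC W A p q K) (hprof : FrameProfile W A p q K)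
    {m : ℕ} (hm0 : m ≠ 0) (dm : KolyvaginFamilyData W K S.ιc m) (M : ℕ) :
    IsAdmissible (absoluteGaloisGroup K) dm.pointsSubgroup ((p ^ M : ℕ) : ℤ) :=
  ShimuraWalk.isAdmissible_pointsSubgroup_familyData hprof.quad dm fun n' a ha ↦
    RingClassNoTorsion.eq_zero_of_zsmul_pow_eq_zero_ringClassField W hprof.quad S.ιc hm0 (Fact.out : p.Prime)
      (p_ne_two_of_frameProfile hprof) hprof.surj n' a ha

/-- **hbot**: `E(K)[p] = 0` on a served frame (`ρ̄` onto ⟹ `E[p]` irreducible). [cite: GrossLMS1991, §2] -/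
theorem torsionBy_eq_bot_of_frameProfile (hprof : FrameProfile W A p q K) :
    AddSubgroup.torsionBy (W.baseChange K).toAffine.Point (p : ℤ) = ⊥ := by
  have hp : p.Prime := Fact.out
  haveI : NeZero (p : ℚ) := ⟨by exact_mod_cast hp.ne_zero⟩
  exact torsionBy_eq_bot_of_isImaginaryQuadratic_of_hasIrreducibleModPGaloisRep W K hprof.quad hp
    (hasIrreducibleModPGaloisRep_of_hasSurjectiveModNGaloisRep W p (by exact_mod_cast hprof.surj))

/-- **hP per datum**: `[P_m] ∈ (E(K[m]) ⊆ E(K̄))^{Γ_K}` mod `p^M` (`M ≥ 1`, Gross depth `M` at the primes of `m`) for ANY datum on the genus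
labelled family. [cite: GrossLMS1991, §4 (4.4), Prop. 3.7 (1)] -/
theorem invPoints_datum_of_frameProfile [NeZero (W.conductorNorm ℤ)]
    (S : GenusHeegnerSettingRC W A p q K) (hprof : FrameProfile W A p q K)
    (DtW : ModularParametrizationData W (W.conductorNorm ℤ))
    {yK : (W.baseChange K).toAffine.Point}
    {ys : (m : ℕ) → (W.baseChange (ringClassField K S.ιc m)).toAffine.Point} {ε₀ : ℤ}
    (hL : ShimuraWalk.LabelsAt W (2 * W.conductorNorm ℤ) K S.ιc yK ys ε₀)
    {M m : ℕ} (hM : 1 ≤ M) (hm : Squarefree m)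
    (hKol : ∀ q' ∈ m.primeFactors, IsKolyvaginPrime (W.conductorNorm ℤ) W K p q' ∧ FrobEqFrobInfty W K (p ^ M) q')
    (dm : KolyvaginFamilyData W K S.ιc m) (hdy : dm.y = ys m) :
    dm.toGeomPoints dm.derivedPoint ∈ invPoints (absoluteGaloisGroup K) dm.pointsSubgroup ((p ^ M : ℕ) : ℤ) := by
  have hK : IsImaginaryQuadratic K := hprof.quad
  have hguard := guard_two_mul_level_of_frameProfile_gross hprof fun q' hq' ↦ (hKol q' hq').1
  obtain ⟨d, hdy', hdm⟩ := exists_tower_through_datum hK S.ιc hm (fun q' hq' ↦ (hguard q' hq').2) ys dm hdy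
  obtain ⟨hB4d, -, -⟩ := ShimuraWalk.familyLabels_of_labelsAt (W := W) hm hguard ys hL d hdy'
  have h := ShimuraWalk.toGeomPoints_derivedPoint_familyData_mem_invPoints hK S.ιc (Fact.out : p.Prime) hM DtW hm hKol d hB4d m
    dvd_rfl
  rwa [hdm] at h

/-- **hsign per datum (class form)**: `τ c_M(dm) = ε₀ (−1)^{ω(m)} c_M(dm)` for ANY datum on the genus labelled family
(Gross Prop. 5.4 (2), from (B3) + (B4) at the guard `2N_W`). [cite: GrossLMS1991, §5 Prop. 5.4 (2)] -/
theorem sign_datum_of_frameProfile [NeZero (W.conductorNorm ℤ)]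
    (S : GenusHeegnerSettingRC W A p q K) (hprof : FrameProfile W A p q K)
    (DtW : ModularParametrizationData W (W.conductorNorm ℤ))
    {yK : (W.baseChange K).toAffine.Point}
    {ys : (m : ℕ) → (W.baseChange (ringClassField K S.ιc m)).toAffine.Point} {ε₀ : ℤ}
    (hL : ShimuraWalk.LabelsAt W (2 * W.conductorNorm ℤ) K S.ιc yK ys ε₀)
    {τ : K ≃ₐ[ℚ] K} (hτ : τ ≠ 1) {M m : ℕ} (hM : 1 ≤ M) (hm : Squarefree m)
    (hKol : ∀ q' ∈ m.primeFactors, IsKolyvaginPrime (W.conductorNorm ℤ) W K p q' ∧ FrobEqFrobInfty W K (p ^ M) q')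
    (dm : KolyvaginFamilyData W K S.ιc m) (hdy : dm.y = ys m) :
    conjAct W τ ((p ^ M : ℕ) : ℤ) (dm.kolyvaginClass (Fact.out : p.Prime) M) =
      (ε₀ * (-1) ^ m.primeFactors.card) • dm.kolyvaginClass (Fact.out : p.Prime) M := by
  have hK : IsImaginaryQuadratic K := hprof.quad
  have hguard := guard_two_mul_level_of_frameProfile_gross hprof fun q' hq' ↦ (hKol q' hq').1
  obtain ⟨d, hdy', hdm⟩ := exists_tower_through_datum hK S.ιc hm (fun q' hq' ↦ (hguard q' hq').2) ys dm hdy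
  obtain ⟨hB4d, -, hB3d⟩ := ShimuraWalk.familyLabels_of_labelsAt (W := W) hm hguard ys hL d hdy'
  have hA : ∀ (m' : ℕ) (hm' : m' ∣ m), IsAdmissible (absoluteGaloisGroup K) (d m' hm').pointsSubgroup ((p ^ M : ℕ) : ℤ) :=
    fun m' hm' ↦ isAdmissible_datum_of_frameProfile S hprof (ne_zero_of_dvd_ne_zero hm.ne_zero hm') (d m' hm') M
  have h := ShimuraWalk.conjAct_kolyvaginClass_familyData_eq_sign_smul hK S.ιc (Fact.out : p.Prime) hM DtW hm hKol d hτ ε₀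
    hB4d hB3d hA m dvd_rfl
  rwa [hdm] at h

/-- **hSel per datum (class level)**: `c_M(dm) ∈ Sel(K_𝔳)` at every finite `𝔳 ∤ m` — INCLUDING the places over `p` (stringent ⟹
Kummer, line owner's p731685) — for ANY datum on the genus labelled family at a square-free Gross–Kolyvagin level of depth `M ≥ 1`.
[cite: GrossLMS1991, Prop. 6.2 (1)] [cite: Jetchev2008, Prop. 4.9, §3.4.1] -/
theorem selmerLocalKer_datum_of_frameProfile [A.IsGloballyMinimal] [NeZero (W.conductorNorm ℤ)]
    (hG1 : ∀ (N : ℕ) [NeZero N] (W : WeierstrassCurve ℚ) (K : Type) [Field K] [NumberField K],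
      phi_heegnerPointOfConductor_mem_range_map_ringClassField_birch N W K)
    (S : GenusHeegnerSettingRC W A p q K) (hprof : FrameProfile W A p q K)
    (DtW : ModularParametrizationData W (W.conductorNorm ℤ)) [∀ j : ℕ, NumberField (ringClassField K S.ιc j)]
    {yK : (W.baseChange K).toAffine.Point}
    {ys : (m : ℕ) → (W.baseChange (ringClassField K S.ιc m)).toAffine.Point} {ε₀ : ℤ}
    (hL : ShimuraWalk.LabelsAt W (2 * W.conductorNorm ℤ) K S.ιc yK ys ε₀)
    (hid : haveI := S.nz; haveI := S.nf; ∀ (c : ℕ), c ≠ 0 → c.Coprime (S.E'.conductorNorm ℤ) →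
      ∀ δ : GenusKolyvaginDatum S.E' K S.ιc S.Dt S.β S.d₁ c,
        genusTransport W S.E' S.D S.C₂ S.hWd K S.ιc δ = ys c ∨ genusTransport W S.E' S.D S.C₂ S.hWd K S.ιc δ = -ys c)
    {M m : ℕ} (hM : 1 ≤ M) (hm : Squarefree m)
    (hKol : ∀ q' ∈ m.primeFactors, IsKolyvaginPrime (W.conductorNorm ℤ) W K p q' ∧ FrobEqFrobInfty W K (p ^ M) q')
    (dm : KolyvaginFamilyData W K S.ιc m) (hdy : dm.y = ys m)
    (𝔳 : HeightOneSpectrum (𝓞 K)) (h𝔳 : ((m : ℕ) : 𝓞 K) ∉ 𝔳.asIdeal) :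
    dm.kolyvaginClass (Fact.out : p.Prime) M ∈ selmerLocalKer (W.baseChange K) (𝔳.adicCompletion K) ((p ^ M : ℕ) : ℤ) := by
  have hp : p.Prime := Fact.out
  have hK : IsImaginaryQuadratic K := hprof.quad
  haveI : (W.baseChange K).IsElliptic := by unfold WeierstrassCurve.baseChange; infer_instance
  have hguard := guard_two_mul_level_of_frameProfile_gross hprof fun q' hq' ↦ (hKol q' hq').1
  obtain ⟨d, hdy', hdm⟩ := exists_tower_through_datum hK S.ιc hm (fun q' hq' ↦ (hguard q' hq').2) ys dm hdy
  obtain ⟨hB4d, -, -⟩ := ShimuraWalk.familyLabels_of_labelsAt (W := W) hm hguard ys hL d hdy'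
  have hA : ∀ (m' : ℕ) (hm' : m' ∣ m) (M' : ℕ),
      IsAdmissible (absoluteGaloisGroup K) (d m' hm').pointsSubgroup ((p ^ M' : ℕ) : ℤ) :=
    fun m' hm' M' ↦ isAdmissible_datum_of_frameProfile S hprof (ne_zero_of_dvd_ne_zero hm.ne_zero hm') (d m' hm') M'
  -- Zhang currency for the line owner's theorem
  have hKolZ : ∀ q' ∈ m.primeFactors, Zhang2014.IsKolyvaginPrime (W.conductorNorm ℤ) W K p q' :=
    fun q' hq' ↦ (X11b.Three.Koly.zhang_isKolyvaginPrime_of_frobEqFrobInfty (W := W) (K := K) hp hM (hKol q' hq').1 (hKol q' hq').2).1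
  have hkn : (M : ℕ∞) ≤ Zhang2014.levelIndex W p m := Zhang2014.natCast_le_levelIndex_iff.mpr fun q' hq' ↦
    (X11b.Three.Koly.zhang_isKolyvaginPrime_of_frobEqFrobInfty (W := W) (K := K) hp hM (hKol q' hq').1 (hKol q' hq').2).2
  have hN : ((p ^ M : ℕ) : ℤ) ≠ 0 := by exact_mod_cast pow_ne_zero M hp.ne_zero
  -- no prime of `m` lies under `𝔳`
  have hw : ∀ ℓ ∈ m.primeFactors, ¬ PlaceOver K (Sum.inr 𝔳 : Place K) ℓ := by
    rintro ℓ hℓ ⟨𝔳', h1, h2⟩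
    have h1' : 𝔳' = 𝔳 := (Sum.inr.inj h1).symm
    subst h1'
    obtain ⟨k, hk⟩ := Nat.dvd_of_mem_primeFactors hℓ
    exact h𝔳 (by rw [hk, Nat.cast_mul]; exact 𝔳'.asIdeal.mul_mem_right _ h2)
  have hkum := localization_kolyvaginClass_mem_kummer_of_frameProfile W A p q K S hprof hG1 DtW hid hM hN hm hKolZ hkn d hdy'
    hB4d hA dvd_rfl (Sum.inr 𝔳) hw
  rw [hdm] at hkum
  have h' : dm.kolyvaginClass hp M ∈
      ((W.baseChange K).kummerSelmerStructure ((p ^ M : ℕ) : ℤ) (Sum.inr 𝔳)).comap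
        (galoisCohomology.localization ((W.baseChange K).torsionGaloisModule ((p ^ M : ℕ) : ℤ)) (Sum.inr 𝔳) 1) :=
    AddSubgroup.mem_comap.mpr hkum
  rwa [(W.baseChange K).comap_localization_kummerSelmerStructure] at h'

end Frame

end Summit.BirchSwinnertonDyer.BirchSwinnertonDyer.Theorems.GenusLine

end
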